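import Mathlib
import Literature.AlgebraicGeometry.Morphisms.CechH1LocalVanishing
import HarnessLib

/-!
# Čech `Ȟ¹(𝒰, 𝒪)`: transport of the vanishing `Ž¹ ⊆ B̌¹` and a flexible local-to-global criterion

Topic: `Literature/AlgebraicGeometry/Morphisms`.  Universe-polymorphic Literature home of four cochain-level
tools of the W4.4 support programme «P_G LERAY» (their universe-`0` originals live Summits-side in
`…Theorems.HomologicalConductorSurfaceTerminationGenusDomination`, namespace `…GenusDescent`, under the names
`cechZ1_le_cechB1_iff_of_base` / `…_of_subsingleton` / `…_of_comap` / `…_of_forall_stalk`; the names here are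
deliberately different so that files opening both namespaces see no ambiguity):

* `cechZ1_le_cechB1_irrel_base` — `Ž¹ ⊆ B̌¹` does not depend on the ring over which the Čech groups are
  regarded as modules;
* `cechZ1_le_cechB1_of_subsingleton_cechH1` — a subsingleton `Ȟ¹` means `Ž¹ ⊆ B̌¹`;
* `cechZ1_le_cechB1_of_comap_bijective` — transport of `Ž¹ ⊆ B̌¹` backwards along a morphism whose section
  maps are bijective (an open immersion and a family of opens inside its range);
* `cechZ1_le_cechB1_of_forall_isLocalization` — `Ȟ¹(𝒰, 𝒪_X) = 0` as soon as it vanishes after base change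
  along SOME localisation datum at every maximal ideal (any `IsLocalization`/`IsPullback` presentation;
  the flexible form of `cechZ1_le_cechB1_of_forall_maximal`).

All four are used by `Resolution/CechH1DominationPointwise` (Leray in degree one along a proper birational
morphism of regular surfaces, pointwise form).  No definitions, no named facts.

## References
* A. Grothendieck, J. Dieudonné, EGA III₁ (1961), Prop. (1.4.15). [EGAIII1]
* The Stacks Project, Tag 01ED (Cohomology, Section 20.9: functoriality of Čech cohomology). [StacksProject]
-/

noncomputable section

open CategoryTheory CategoryTheory.Limits AlgebraicGeometry TopologicalSpace

universe u v

namespace Literature.AlgebraicGeometry.Morphisms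

namespace CechLocalization

/-! ## Structure-map independence and transport of the vanishing `Ž¹ ≤ B̌¹` -/

section Transport

variable {A B : Type u} [CommRing A] [CommRing B] {X Y : Scheme.{u}}

/-- `Ž¹ ⊆ B̌¹` does not depend on the base ring through which the Čech groups are regarded as
modules (the cochain maps are the same functions). [cite: StacksProject, Tag 01ED (Cohomology, Section 20.9)] -/
theorem cechZ1_le_cechB1_irrel_base (f : X ⟶ Spec (.of A)) (f' : X ⟶ Spec (.of B)) {ι : Type v}
    (U : ι → X.Opens) : cechZ1 f U ≤ cechB1 f U ↔ cechZ1 f' U ≤ cechB1 f' U := by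
  constructor <;> intro h c hc
  · obtain ⟨b, hb⟩ := (mem_cechB1_iff f U c).mp (h ((mem_cechZ1_iff f U c).mpr
      ((mem_cechZ1_iff f' U c).mp hc)))
    exact (mem_cechB1_iff f' U c).mpr ⟨b, hb⟩
  · obtain ⟨b, hb⟩ := (mem_cechB1_iff f' U c).mp (h ((mem_cechZ1_iff f' U c).mpr
      ((mem_cechZ1_iff f U c).mp hc)))
    exact (mem_cechB1_iff f U c).mpr ⟨b, hb⟩

/-- A subsingleton `Ȟ¹` means `Ž¹ ⊆ B̌¹`. [cite: StacksProject, Tag 01ED (Cohomology, Section 20.9)] -/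
theorem cechZ1_le_cechB1_of_subsingleton_cechH1 (f : X ⟶ Spec (.of A)) {ι : Type v} (U : ι → X.Opens)
    (h : Subsingleton (CechH1 f U)) : cechZ1 f U ≤ cechB1 f U := fun c hc =>
  (CechH1.mk_eq_zero_iff f U ⟨c, hc⟩).mp (Subsingleton.elim _ _)

/-- **Transport of `Ž¹ ⊆ B̌¹` backwards along a morphism whose section maps are bijective** (e.g. an
open immersion and a family of opens inside its range): if `Ȟ¹(g⁻¹𝒢, 𝒪_Y) = 0` then `Ȟ¹(𝒢, 𝒪_X) = 0`.
[cite: StacksProject, Tag 01ED (Cohomology, Section 20.9)] -/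
theorem cechZ1_le_cechB1_of_comap_bijective (fX : X ⟶ Spec (.of A)) (fY : Y ⟶ Spec (.of A))
    (g : Y ⟶ X) (hg : g ≫ fX = fY) {ι : Type v} (U : ι → X.Opens)
    (h0 : ∀ i, Function.Surjective (Sections.comap fX fY g hg (le_refl (g ⁻¹ᵁ U i))))
    (h1 : ∀ i j, Function.Injective (Sections.comap fX fY g hg
      (show g ⁻¹ᵁ U i ⊓ g ⁻¹ᵁ U j ≤ g ⁻¹ᵁ (U i ⊓ U j) from fun _ hx => hx)))
    (h : cechZ1 fY (preimageFamily g U) ≤ cechB1 fY (preimageFamily g U)) :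
    cechZ1 fX U ≤ cechB1 fX U := by
  intro c hc
  obtain ⟨b', hb'⟩ := (mem_cechB1_iff fY _ _).mp (h (comapC1_mem_cechZ1 fX fY g hg U hc))
  choose b hb using fun i => h0 i (b' i)
  refine (mem_cechB1_iff fX U c).mpr ⟨b, ?_⟩
  ext i j
  apply h1 i j
  have e := congrFun (congrFun (cechD0_comapC0 fX fY g hg U b) i) j
  have hbb : cechComapC0 fX fY g hg U b = b' := by
    ext i; exact hb i
  rw [hbb, hb'] at e
  rw [cechComapC1_apply] at e
  exact e.symm

end Transport

/-! ## Flexible local-to-global vanishing -/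

section LocalGlobal

variable {A : Type u} [CommRing A] {X : Scheme.{u}} (f : X ⟶ Spec (.of A)) {ι : Type v} [Finite ι]
  (U : ι → X.Opens)

/-- **`Ȟ¹(𝒰, 𝒪_X) = 0` if it vanishes after base change along SOME localisation datum at every maximal
ideal**: for each maximal `𝔪`, a ring `A'` with `IsLocalization 𝔪.primeCompl A'`, a cartesian square
`Y = X ×_A Spec A'` (any presentation) and the vanishing on `Y`; for a finite family of affine opens with
affine pairwise and triple intersections (flexible form of `cechZ1_le_cechB1_of_forall_maximal`: the
pullback on `Ȟ¹` is a localisation at `𝔪`, `isLocalizedModule_cechComapH1`, so every class is killed by an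
element outside every maximal ideal). [cite: EGAIII1, Prop. (1.4.15)] -/
theorem cechZ1_le_cechB1_of_forall_isLocalization (hU : ∀ i, IsAffineOpen (U i))
    (hU2 : ∀ i j, IsAffineOpen (U i ⊓ U j)) (hU3 : ∀ i j k, IsAffineOpen (U i ⊓ U j ⊓ U k))
    (h : ∀ (𝔪 : Ideal A) [𝔪.IsMaximal], ∃ (A' : Type u) (_ : CommRing A') (_ : Algebra A A')
      (_ : IsLocalization 𝔪.primeCompl A') (Y : Scheme.{u}) (fY' : Y ⟶ Spec (.of A')) (g : Y ⟶ X)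
      (_ : IsPullback g fY' f (Spec.map (CommRingCat.ofHom (algebraMap A A')))),
      cechZ1 (fY' ≫ Spec.map (CommRingCat.ofHom (algebraMap A A'))) (preimageFamily g U) ≤
        cechB1 (fY' ≫ Spec.map (CommRingCat.ofHom (algebraMap A A'))) (preimageFamily g U)) :
    cechZ1 f U ≤ cechB1 f U := by
  intro z hz
  set c : CechH1 f U := CechH1.mk f U ⟨z, hz⟩ with hc
  suffices hc0 : c = 0 by exact (CechH1.mk_eq_zero_iff f U ⟨z, hz⟩).mp hc0
  have hkill : ∀ (𝔪 : Ideal A) [𝔪.IsMaximal], ∃ s : A, s ∉ 𝔪 ∧ s • c = 0 := by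
    intro 𝔪 _
    obtain ⟨A', _, _, _, Y, fY', g, H, hv⟩ := h 𝔪
    haveI hloc := isLocalizedModule_cechComapH1 𝔪.primeCompl f fY'
      (fY' ≫ Spec.map (CommRingCat.ofHom (algebraMap A A'))) g rfl H U hU hU2 hU3
    have himg : cechComapH1 f (fY' ≫ Spec.map (CommRingCat.ofHom (algebraMap A A'))) g H.w U c =
        0 := by
      rw [hc, cechComapH1_mk, CechH1.mk_eq_zero_iff, cechComapZ1_coe]
      exact hv (comapC1_mem_cechZ1 f _ _ _ U hz)
    obtain ⟨s, hs⟩ := (IsLocalizedModule.eq_zero_iff 𝔪.primeCompl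
      (cechComapH1 f (fY' ≫ Spec.map (CommRingCat.ofHom (algebraMap A A'))) g H.w U)).mp himg
    exact ⟨s, s.2, hs⟩
  by_contra hne
  let I : Ideal A := (LinearMap.toSpanSingleton A (CechH1 f U) c).ker
  have hI : I ≠ ⊤ := by
    intro hI
    have h1 : (1 : A) ∈ I := hI ▸ Submodule.mem_top
    have : (1 : A) • c = 0 := h1
    exact hne (by simpa using this)
  obtain ⟨𝔪, h𝔪, hI𝔪⟩ := Ideal.exists_le_maximal I hI
  obtain ⟨s, hs𝔪, hsc⟩ := hkill 𝔪
  exact hs𝔪 (hI𝔪 (show s ∈ I from hsc))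

end LocalGlobal

end CechLocalization

end Literature.AlgebraicGeometry.Morphisms

end
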